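import Summits.QuantumFields.YangMills.Theorems.ForcedResponseSkewnessResponseLocalisationSmearedDefs
import Summits.QuantumFields.YangMills.Theorems.ForcedResponseSkewnessRunningCouplingCeilingDefs
import Summits.QuantumFields.YangMills.Theorems.ForcedResponseSkewnessResponseLocalisationCentredOscToolkit
import HarnessLib

/-!
# Route `ForcedResponseSkewness`: the CENTRED engine forms of the two AF stubs are not stronger than the laws they
# replace (converse directions; equivalence modulo `FBL`)

Helper file (`--supports stmt-QuantumFields-26871`, width seat `ym-line-frs-p2` g7).  The lead `ym-line-frs-p1` g5 re-registered
the asymptotic-freedom stubs of the route's two femto cruxes in ENGINE FORM — crux 26871 (`ResponseLocalisation` rev 6, skeleton v3):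
`stub_centredOsc : CentredOscLawSigR` with the reduction `CentredOsc.symNearCovLawSigR_of_centredOsc` (p620449); crux 24275
(`RunningCouplingCeiling`, skeleton v5): `stub_centredFemtoLog : CentredFemtoLogSigR` with `CentredLog.femtoLogSigR_of_centred` — and
states in the Defs docstrings that nothing is lost.  This file is the kernel-checked form of that remark, for the vet / tribunal record:

* `centredOscLaw_of_symNearCovLaw` — `SymNearCovLaw G r a → CentredOscLaw G r a` (centred cubes are cubes; two exteriors are compared
  through the reference values `n_β` by the triangle inequality, `κ ↦ κ/2`); pinned form `centredOscLawSigR_of_symNearCovLawSigR`.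
* `centredFemtoLogSigR_of_femtoLogSigR` — `FemtoLogSigR → CentredFemtoLogSigR` (specialise to the centred cube and the base point
  `x = 0`; the centre has depth `≥ N+1` and `y` has depth `≥ N+1−‖y‖`, `CentredOsc.le_depth_centre` /
  `CentredOsc.le_depth_centred_of_norm_le`).

Together with the lead's reductions: modulo the frozen-boundary law `FBL` (the shared engine stub), `CentredOscLawSigR ↔ SymNearCovLawSigR`
and `CentredFemtoLogSigR ↔ FemtoLogSigR` up to the constants recorded there — the v3/v5 reshapes re-index the debts, they neither
strengthen nor weaken them.  Honest label: bookkeeping inside a CONDITIONAL rung line (leaf R2a `BalabanLadder.NT`); none of the four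
laws, `FBL6`, the cruxes, NT or the YM mass gap is proved here.
-/

set_option autoImplicit false

noncomputable section

open MeasureTheory Filter Topology
open Literature.MathematicalPhysics.QuantumFieldTheory Literature.MathematicalPhysics.QuantumLattice
open Literature.Probability.LatticeModels
open Summit.QuantumFields.YangMills.Cruxes.OSLegsFromFemtoAndGap.DlrCollarTransfer
open Summit.QuantumFields.YangMills.Cruxes.ResponseLocalisation.Birth
open Summit.QuantumFields.YangMills.Cruxes.ResponseLocalisation.CentredOsc (le_depth_centre le_depth_centred_of_norm_le)
open Summit.QuantumFields.YangMills.Cruxes.RunningCouplingCeiling.Pointwise (FemtoLogSigR CentredFemtoLogSigR)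

namespace Summit.QuantumFields.YangMills.Cruxes.ResponseLocalisation.CentredConverse

section Osc

variable (G : Type) [Group G] [TopologicalSpace G] [IsTopologicalGroup G] [CompactSpace G]
  [MeasurableSpace G] [BorelSpace G] (r : LatticeRep G)

/-- **Centred cubes are cubes**: the signed radially smeared near-pair law with reference values (`SymNearCovLaw`) implies its
centred, reference-free oscillation form (`CentredOscLaw`) — apply the law at the centre `0` of `[-N,N]⁴` under both exteriors and
compare through `n_β` (triangle inequality; the law is invoked at `κ/2`). [folklore] -/
theorem centredOscLaw_of_symNearCovLaw (a : ℝ → ℝ) (h : SymNearCovLaw G r a) : CentredOscLaw G r a := by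
  obtain ⟨ℓ₂, hℓ₂, H⟩ := h
  refine ⟨ℓ₂, hℓ₂, fun κ hκ d₀ hd₀ hd₀ℓ => ?_⟩
  obtain ⟨R, hR0, hRd₀, β₂, n, HR⟩ := H (κ / 2) (by positivity) d₀ hd₀ hd₀ℓ
  refine ⟨R, hR0, hRd₀, β₂, fun β hβ N hNℓ hRN hdN η η' B hB φ hφ1 hφR => ?_⟩
  -- the centre of the centred cube has depth `≥ N + 1`
  have hc0 : (fun j => (0 : Fin 4 → ℤ) j - (N : ℤ)) = fun _ => -(N : ℤ) := by funext j; simp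
  have hdep : (N : ℝ) + 1 ≤ (depth (fun _ => -(N : ℤ)) (2 * N + 1) 0 : ℝ) := by
    have := le_depth_centre (0 : Fin 4 → ℤ) N
    rwa [hc0] at this
  have hD0 : (0 : ℝ) < (N : ℝ) + 1 := by positivity
  have hRdep : R / a β + 2 ≤ (depth (fun _ => -(N : ℤ)) (2 * N + 1) 0 : ℝ) := hRN.trans hdep
  have hddep : d₀ ≤ a β * (depth (fun _ => -(N : ℤ)) (2 * N + 1) 0 : ℝ) := by
    have ha : 0 ≤ a β := by
      -- `R / a β + 2 ≤ N + 1` with `R > 0` forces `a β ≥ 0` unless the division is junk; either way `d₀ ≤ a β (N+1)` and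
      -- `0 < d₀` give `0 < a β (N+1)`, hence `0 ≤ a β`.
      have h1 : 0 < a β * ((N : ℝ) + 1) := lt_of_lt_of_le hd₀ hdN
      nlinarith
    exact hdN.trans (mul_le_mul_of_nonneg_left hdep ha)
  have hb : ((2 * N + 1 : ℕ) : ℝ) * a β ≤ ℓ₂ := hNℓ
  -- the law under the two exteriors, at `z = 0`
  have key : ∀ ξ : LGConfig 4 G, |∑ w ∈ B, φ (a β * ‖siteToE w‖) *
      (kerCov G r β (fun _ => -(N : ℤ)) (2 * N + 1) ξ (dens G r w) (dens G r 0) - n β w)| ≤ κ / 2 / ((N : ℝ) + 1) ^ 4 := by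
    intro ξ
    have h1 := HR β hβ (fun _ => -(N : ℤ)) (2 * N + 1) hb ξ 0 B hB hRdep hddep φ hφ1 hφR
    simp only [zero_add] at h1
    exact h1.trans (div_le_div_of_nonneg_left (by positivity) (by positivity) (pow_le_pow_left₀ hD0.le hdep 4))
  have e : ∑ w ∈ B, φ (a β * ‖siteToE w‖) *
        (kerCov G r β (fun _ => -(N : ℤ)) (2 * N + 1) η (dens G r w) (dens G r 0) -
          kerCov G r β (fun _ => -(N : ℤ)) (2 * N + 1) η' (dens G r w) (dens G r 0)) =
      (∑ w ∈ B, φ (a β * ‖siteToE w‖) *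
        (kerCov G r β (fun _ => -(N : ℤ)) (2 * N + 1) η (dens G r w) (dens G r 0) - n β w)) -
      ∑ w ∈ B, φ (a β * ‖siteToE w‖) *
        (kerCov G r β (fun _ => -(N : ℤ)) (2 * N + 1) η' (dens G r w) (dens G r 0) - n β w) := by
    rw [← Finset.sum_sub_distrib]
    exact Finset.sum_congr rfl fun w _ => by ring
  rw [e]
  have hfin : κ / 2 / ((N : ℝ) + 1) ^ 4 + κ / 2 / ((N : ℝ) + 1) ^ 4 = κ / ((N : ℝ) + 1) ^ 4 := by ring
  exact (abs_sub _ _).trans ((add_le_add (key η) (key η')).trans hfin.le)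

end Osc

/-- **Pinned form**: `SymNearCovLawSigR → CentredOscLawSigR` (so, with `CentredOsc.symNearCovLawSigR_of_centredOsc`, the v3 engine
form of crux 26871's AF stub is equivalent to the v2 statement modulo `FBLPinnedSigR`). [folklore] -/
theorem centredOscLawSigR_of_symNearCovLawSigR (h : SymNearCovLawSigR) : CentredOscLawSigR := by
  intro G _ _ _ _ hG
  letI : MeasurableSpace G := borel G
  haveI : BorelSpace G := ⟨rfl⟩
  intro r a ha hlim hpin
  exact centredOscLaw_of_symNearCovLaw G r a (h G hG r a ha hlim hpin)

/-- **Centred cubes are cubes, two-point version**: the femto log two-point law on every femto cube (`FemtoLogSigR`) implies its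
centred form (`CentredFemtoLogSigR`, same constants) — specialise to `[-N,N]⁴` and the base point `x = 0`: the centre has depth
`≥ N+1 ≥ K‖y‖` and `y` has depth `≥ N+1−‖y‖ ≥ K‖y‖` when `(K+1)‖y‖ ≤ N+1`.  With `CentredLog.femtoLogSigR_of_centred` the v5
engine form of crux 24275's AF stub is equivalent to the v4 statement modulo `FBLPinnedSigR`. [folklore] -/
theorem centredFemtoLogSigR_of_femtoLogSigR (h : FemtoLogSigR) : CentredFemtoLogSigR := by
  intro G _ _ _ _ hG
  letI : MeasurableSpace G := borel G
  haveI : BorelSpace G := ⟨rfl⟩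
  intro r a ha hlim hpin
  obtain ⟨ℓ₂, C₂, β₂, K, n₀, hℓ₂, hK1, hKlim, H⟩ := h G hG r a ha hlim hpin
  refine ⟨ℓ₂, C₂, β₂, K, n₀, hℓ₂, hK1, hKlim, fun β hβ N hNℓ η y hn hKN => ?_⟩
  have hc0 : (fun j => (0 : Fin 4 → ℤ) j - (N : ℤ)) = fun _ => -(N : ℤ) := by funext j; simp
  have hy0 : ‖siteToE (y - 0)‖ = ‖siteToE y‖ := by rw [sub_zero]
  have hn0 : 0 ≤ ‖siteToE y‖ := norm_nonneg _
  have hKy : K (‖siteToE y‖ * a β) * ‖siteToE y‖ ≤ (N : ℝ) + 1 := by nlinarith only [hKN, hn0]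
  -- depths in the centred cube: centre `≥ N+1`, the site `y` `≥ N+1−‖y‖`
  have hdep0 : (N : ℝ) + 1 ≤ (depth (fun _ => -(N : ℤ)) (2 * N + 1) 0 : ℝ) := by
    have := le_depth_centre (0 : Fin 4 → ℤ) N
    rwa [hc0] at this
  have hdepy : (N : ℝ) + 1 - ‖siteToE y‖ ≤ (depth (fun _ => -(N : ℤ)) (2 * N + 1) y : ℝ) := by
    have := le_depth_centred_of_norm_le (0 : Fin 4 → ℤ) y N (le_refl ‖siteToE y‖)
    rwa [hc0, zero_add] at this
  have h1 := H β hβ (fun _ => -(N : ℤ)) (2 * N + 1) hNℓ η 0 y (by rw [hy0]; exact hn)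
    (by rw [hy0]; exact hKy.trans hdep0) (by rw [hy0]; linarith only [hKN, hdepy])
  rw [hy0] at h1
  exact h1

end Summit.QuantumFields.YangMills.Cruxes.ResponseLocalisation.CentredConverse

end
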